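import Mathlib
import HarnessLib
import Summits.HubbardSuperconductivity.HubbardSuperconductivity.Theorems.KLProgrammeCutCurrencyDecay

/-!
# Route `KLProgramme` — ENGINE (stmt-HubbardSuperconductivity-20437 `KLRegimeEngineV17F2`), located #25 «(b)-PLAIN-UV-TAIL», cure (α),
# E1 item (i) towards the WEIGHTED rows: the third-difference sum of the cut samples and the CUBIC pointwise decay of the leg transform
# (cell gate-hubbard-kl, seat hubbard-kl-k3c2-p2 g35)

The `klScaleWt_n = 1 + Λ_n·diam` weight of binder #6 costs one physical time moment of the cut one-leg kernel `ĉ`.  This file proves, for `128 ≤ β ≤ M`: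
* `klct_thirdDiffSum_uvCut_le` — `Σ_{v ∈ ℤ_{2M}} |ĝ(ω_{v−3}) − 3ĝ(ω_{v−2}) + 3ĝ(ω_{v−1}) − ĝ(ω_v)| ≤ C₃(β) := 4K₃(2π/β)³(3β/(64π) + 4)`, `K₃ = (32/3)³·5391`
  (four-point bound `…Decay` + two window counts; the three wrap-around terms vanish);
* **`klct_legTransform_uvCut_cube_decay`** — `|ĉ(j)|·(4·min(j,2M−j)/2M)³ ≤ C₃(β)` for every `j` (cyclic summation by parts thrice + the gap);
(the first-moment consequences are in the sequel `…CutCurrencyFirstMomentBound`).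
No definition; nothing asserts any row, (b), (C), K3, U₀, the window or superconductivity.
References: BGM 2006 §2.2–2.3 [cite: BenfattoGiulianiMastropietro2006]; Zygmund, Trigonometric Series I §II.2 [folklore].
-/

noncomputable section

namespace Summit.HubbardSuperconductivity.HubbardSuperconductivity.Theorems.KLRegimeSplit

set_option linter.dupNamespace false -- summit = problem name (single-conjunct summit), D-0017

open Finset Literature.MathematicalPhysics.QuantumLattice

/-! ## §1 Edge frequencies (three deep) and the four-point indicator bound -/

variable {M : ℕ}

/-- **Edge frequencies, three deep** (`3 ≤ β ≤ M`): `ĝ(ω_w) = 0` for `val w ≤ 2` or `val w ≥ 2M − 3`. -/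
theorem klct_uvCutoff_edge3_eq_zero {β : ℝ} (hβ : 3 ≤ β) (hM : β ≤ M) (w : MatsubaraIdx M) (hw : (w : ℕ) ≤ 2 ∨ 2 * M ≤ (w : ℕ) + 3) :
    gnScaleCutoff 4 klE0 1 |matsubaraFreq β M w| = 0 := by
  have hβ0 : 0 < β := by linarith
  have hM3 : (3 : ℝ) ≤ M := hβ.trans hM
  rw [klct_uvCutoff_eq_profile]
  apply klct_profile_eq_zero
  rw [matsubaraFreq, matsubaraInt, abs_div, abs_of_pos hβ0, le_div_iff₀ hβ0, abs_mul, abs_of_pos Real.pi_pos]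
  have hpi := Real.pi_gt_three
  have hkey : 2 * (M : ℝ) - 5 ≤ |2 * (((w : ℕ) : ℤ) - M : ℤ) + (1 : ℝ)| := by
    push_cast
    rcases hw with hw | hw
    · have : ((w : ℕ) : ℝ) ≤ 2 := by exact_mod_cast hw
      rw [abs_of_nonpos (by linarith)]; linarith
    · have : 2 * (M : ℝ) ≤ ((w : ℕ) : ℝ) + 3 := by exact_mod_cast hw
      rw [abs_of_nonneg (by linarith)]; linarith
  nlinarith

/-- One-sided four-point bound WITH INDICATOR: `|ψ(x+3δ) − 3ψ(x+2δ) + 3ψ(x+δ) − ψ(x)| ≤ 2K₃δ³·𝟙[1/32 − 3δ < x < 1/8]` (`0 < δ`). -/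
theorem klct_profile_thirdDiff_indicator (x : ℝ) {δ : ℝ} (hδ : 0 < δ) :
    |Real.smoothTransition (4 / 3 - 32 / 3 * (x + 3 * δ)) - 3 * Real.smoothTransition (4 / 3 - 32 / 3 * (x + 2 * δ)) +
        3 * Real.smoothTransition (4 / 3 - 32 / 3 * (x + δ)) - Real.smoothTransition (4 / 3 - 32 / 3 * x)| ≤
      2 * ((32 / 3) ^ 3 * 5391) * δ ^ 3 * (if 1 / 32 - 3 * δ < x ∧ x < 1 / 8 then 1 else 0) := by
  split_ifs with hw
  · rw [mul_one]; exact klct_profile_thirdDiff_le x hδ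
  rw [mul_zero]
  refine le_of_eq (abs_eq_zero.mpr ?_)
  rw [not_and_or, not_lt, not_lt] at hw
  rcases hw with hlo | hhi
  · rw [klct_profile_eq_one (by linarith : x + 3 * δ ≤ 1 / 32), klct_profile_eq_one (by linarith : x + 2 * δ ≤ 1 / 32),
      klct_profile_eq_one (by linarith : x + δ ≤ 1 / 32), klct_profile_eq_one (by linarith : x ≤ 1 / 32)]; ring
  · rw [klct_profile_eq_zero (by linarith : 1 / 8 ≤ x + 3 * δ), klct_profile_eq_zero (by linarith : 1 / 8 ≤ x + 2 * δ),
      klct_profile_eq_zero (by linarith : 1 / 8 ≤ x + δ), klct_profile_eq_zero hhi]; ring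

/-- **Four-point bound for the CUT profile with indicators**:
`|ĝ(x+3δ) − 3ĝ(x+2δ) + 3ĝ(x+δ) − ĝ(x)| ≤ 2K₃δ³·(𝟙[1/32 − 3δ < x < 1/8] + 𝟙[−1/8 − 3δ < x < −1/32])` (`0 < δ`). -/
theorem klct_absProfile_thirdDiff_indicator (x : ℝ) {δ : ℝ} (hδ : 0 < δ) :
    |Real.smoothTransition (4 / 3 - 32 / 3 * |x + 3 * δ|) - 3 * Real.smoothTransition (4 / 3 - 32 / 3 * |x + 2 * δ|) +
        3 * Real.smoothTransition (4 / 3 - 32 / 3 * |x + δ|) - Real.smoothTransition (4 / 3 - 32 / 3 * |x|)| ≤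
      2 * ((32 / 3) ^ 3 * 5391) * δ ^ 3 * ((if 1 / 32 - 3 * δ < x ∧ x < 1 / 8 then 1 else 0) +
        (if -(1 / 8) - 3 * δ < x ∧ x < -(1 / 32) then 1 else 0)) := by
  simp only [klct_absProfile_eq_sum]
  have h1 := klct_profile_thirdDiff_indicator x hδ
  have h2 := klct_profile_thirdDiff_indicator (-x - 3 * δ) hδ
  rw [show -x - 3 * δ + 3 * δ = -x by ring, show -x - 3 * δ + 2 * δ = -(x + δ) by ring, show -x - 3 * δ + δ = -(x + 2 * δ) by ring,
    show -x - 3 * δ = -(x + 3 * δ) by ring] at h2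
  have hiff : (if 1 / 32 - 3 * δ < -(x + 3 * δ) ∧ -(x + 3 * δ) < 1 / 8 then (1:ℝ) else 0) = (if -(1 / 8) - 3 * δ < x ∧ x < -(1 / 32) then 1 else 0) := by
    by_cases h : -(1 / 8) - 3 * δ < x ∧ x < -(1 / 32)
    · rw [if_pos h, if_pos ⟨by linarith [h.2], by linarith [h.1]⟩]
    · rw [if_neg h, if_neg (fun h' => h ⟨by linarith [h'.2], by linarith [h'.1]⟩)]
  rw [hiff] at h2
  have hsplit : Real.smoothTransition (4 / 3 - 32 / 3 * (x + 3 * δ)) + Real.smoothTransition (4 / 3 - 32 / 3 * -(x + 3 * δ)) - 1 -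
        3 * (Real.smoothTransition (4 / 3 - 32 / 3 * (x + 2 * δ)) + Real.smoothTransition (4 / 3 - 32 / 3 * -(x + 2 * δ)) - 1) +
        3 * (Real.smoothTransition (4 / 3 - 32 / 3 * (x + δ)) + Real.smoothTransition (4 / 3 - 32 / 3 * -(x + δ)) - 1) -
        (Real.smoothTransition (4 / 3 - 32 / 3 * x) + Real.smoothTransition (4 / 3 - 32 / 3 * -x) - 1) =
      (Real.smoothTransition (4 / 3 - 32 / 3 * (x + 3 * δ)) - 3 * Real.smoothTransition (4 / 3 - 32 / 3 * (x + 2 * δ)) +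
        3 * Real.smoothTransition (4 / 3 - 32 / 3 * (x + δ)) - Real.smoothTransition (4 / 3 - 32 / 3 * x)) -
      (Real.smoothTransition (4 / 3 - 32 / 3 * -x) - 3 * Real.smoothTransition (4 / 3 - 32 / 3 * -(x + δ)) +
        3 * Real.smoothTransition (4 / 3 - 32 / 3 * -(x + 2 * δ)) - Real.smoothTransition (4 / 3 - 32 / 3 * -(x + 3 * δ))) := by ring
  rw [hsplit]
  exact (abs_sub _ _).trans ((add_le_add h1 h2).trans (le_of_eq (by ring)))

/-! ## §2 The third-difference sum of the cut samples -/

variable [NeZero M]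

/-- **The cyclic third-difference sum of the cut samples** (`128 ≤ β ≤ M`, `δ = 2π/β`):
`Σ_{v ∈ ℤ_{2M}} |ĝ(ω_{v−3}) − 3ĝ(ω_{v−2}) + 3ĝ(ω_{v−1}) − ĝ(ω_v)| ≤ 4K₃(2π/β)³·(3β/(64π) + 4)`, `K₃ = (32/3)³·5391`. -/
theorem klct_thirdDiffSum_uvCut_le {β : ℝ} (hβ : 128 ≤ β) (hM : β ≤ M) :
    ∑ v : MatsubaraIdx M, ‖(((gnScaleCutoff 4 klE0 1 |matsubaraFreq β M (v - 1 - 1 - 1)| : ℝ) : ℂ)) -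
        3 * (((gnScaleCutoff 4 klE0 1 |matsubaraFreq β M (v - 1 - 1)| : ℝ) : ℂ)) + 3 * (((gnScaleCutoff 4 klE0 1 |matsubaraFreq β M (v - 1)| : ℝ) : ℂ)) -
        (((gnScaleCutoff 4 klE0 1 |matsubaraFreq β M v| : ℝ) : ℂ))‖ ≤
      4 * ((32 / 3) ^ 3 * 5391) * (2 * Real.pi / β) ^ 3 * (3 * β / (64 * Real.pi) + 4) := by
  classical
  have hβ0 : 0 < β := by linarith
  have hβ3 : (3 : ℝ) ≤ β := by linarith
  have hpi := Real.pi_pos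
  have hMne := NeZero.ne M
  set δ : ℝ := 2 * Real.pi / β with hδ
  have hδ0 : 0 < δ := by positivity
  set K₃ : ℝ := (32 / 3) ^ 3 * 5391 with hK₃
  -- the two windows of base points `x = ω_v − 3δ`
  set W₁ := (univ : Finset (MatsubaraIdx M)).filter (fun v : MatsubaraIdx M => 3 ≤ (v : ℕ) ∧
      (1 / 32 - 3 * δ < matsubaraFreq β M v - 3 * δ ∧ matsubaraFreq β M v - 3 * δ < 1 / 8)) with hW₁
  set W₂ := (univ : Finset (MatsubaraIdx M)).filter (fun v : MatsubaraIdx M => 3 ≤ (v : ℕ) ∧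
      (-(1 / 8) - 3 * δ < matsubaraFreq β M v - 3 * δ ∧ matsubaraFreq β M v - 3 * δ < -(1 / 32))) with hW₂
  have hpt : ∀ v : MatsubaraIdx M,
      ‖(((gnScaleCutoff 4 klE0 1 |matsubaraFreq β M (v - 1 - 1 - 1)| : ℝ) : ℂ)) -
          3 * (((gnScaleCutoff 4 klE0 1 |matsubaraFreq β M (v - 1 - 1)| : ℝ) : ℂ)) + 3 * (((gnScaleCutoff 4 klE0 1 |matsubaraFreq β M (v - 1)| : ℝ) : ℂ)) -
          (((gnScaleCutoff 4 klE0 1 |matsubaraFreq β M v| : ℝ) : ℂ))‖ ≤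
        2 * K₃ * δ ^ 3 * ((if v ∈ W₁ then 1 else 0) + (if v ∈ W₂ then 1 else 0)) := by
    intro v
    have hnorm : ∀ a b c d : ℝ, ‖((a : ℝ) : ℂ) - 3 * ((b : ℝ) : ℂ) + 3 * ((c : ℝ) : ℂ) - ((d : ℝ) : ℂ)‖ = |d - 3 * c + 3 * b - a| := by
      intro a b c d
      rw [show ((a : ℝ) : ℂ) - 3 * ((b : ℝ) : ℂ) + 3 * ((c : ℝ) : ℂ) - ((d : ℝ) : ℂ) = (((a - 3 * b + 3 * c - d : ℝ)) : ℂ) by push_cast; ring,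
        Complex.norm_real, Real.norm_eq_abs, show a - 3 * b + 3 * c - d = -(d - 3 * c + 3 * b - a) by ring, abs_neg]
    rw [hnorm]
    by_cases hv3 : 3 ≤ (v : ℕ)
    · have hv1 : 1 ≤ (v : ℕ) := by omega
      have e1v : (((v - 1 : MatsubaraIdx M)) : ℕ) = (v : ℕ) - 1 := klct_val_sub_one hv1
      have hv1' : 1 ≤ (((v - 1 : MatsubaraIdx M)) : ℕ) := by rw [e1v]; omega
      have e2v : (((v - 1 - 1 : MatsubaraIdx M)) : ℕ) = (v : ℕ) - 2 := by rw [klct_val_sub_one hv1', e1v]; omega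
      have hv1'' : 1 ≤ (((v - 1 - 1 : MatsubaraIdx M)) : ℕ) := by rw [e2v]; omega
      have e1 : matsubaraFreq β M (v - 1) = matsubaraFreq β M v - δ := klct_matsubaraFreq_sub_one hβ0.ne' hv1
      have e2 : matsubaraFreq β M (v - 1 - 1) = matsubaraFreq β M v - 2 * δ := by
        rw [klct_matsubaraFreq_sub_one hβ0.ne' hv1', e1]; ring
      have e3 : matsubaraFreq β M (v - 1 - 1 - 1) = matsubaraFreq β M v - 3 * δ := by
        rw [klct_matsubaraFreq_sub_one hβ0.ne' hv1'', e2]; ring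
      rw [e1, e2, e3, klct_uvCutoff_eq_profile, klct_uvCutoff_eq_profile, klct_uvCutoff_eq_profile, klct_uvCutoff_eq_profile]
      have hind := klct_absProfile_thirdDiff_indicator (matsubaraFreq β M v - 3 * δ) hδ0
      rw [show matsubaraFreq β M v - 3 * δ + 3 * δ = matsubaraFreq β M v by ring, show matsubaraFreq β M v - 3 * δ + 2 * δ = matsubaraFreq β M v - δ by ring,
        show matsubaraFreq β M v - 3 * δ + δ = matsubaraFreq β M v - 2 * δ by ring] at hind
      have hw1 : (if 1 / 32 - 3 * δ < matsubaraFreq β M v - 3 * δ ∧ matsubaraFreq β M v - 3 * δ < 1 / 8 then (1:ℝ) else 0) = (if v ∈ W₁ then 1 else 0) := by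
        simp only [hW₁, Finset.mem_filter, Finset.mem_univ, true_and, hv3]
      have hw2 : (if -(1 / 8) - 3 * δ < matsubaraFreq β M v - 3 * δ ∧ matsubaraFreq β M v - 3 * δ < -(1 / 32) then (1:ℝ) else 0) = (if v ∈ W₂ then 1 else 0) := by
        simp only [hW₂, Finset.mem_filter, Finset.mem_univ, true_and, hv3]
      rw [← hw1, ← hw2]
      exact hind
    · -- wrap-around terms: all four samples are edge frequencies
      push Not at hv3
      have hvW₁ : v ∉ W₁ := by intro hmem; have := (Finset.mem_filter.mp hmem).2.1; omega
      have hvW₂ : v ∉ W₂ := by intro hmem; have := (Finset.mem_filter.mp hmem).2.1; omega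
      rw [if_neg hvW₁, if_neg hvW₂, add_zero, mul_zero]
      -- values of the three predecessors
      have hp1 : ((((v - 1 : MatsubaraIdx M)) : ℕ) = (v : ℕ) - 1 ∧ 1 ≤ (v : ℕ)) ∨ ((((v - 1 : MatsubaraIdx M)) : ℕ) = 2 * M - 1 ∧ (v : ℕ) = 0) := by
        rcases Nat.lt_or_ge (v : ℕ) 1 with h0 | h1
        · right; exact ⟨klct_val_sub_one_of_zero (by omega), by omega⟩
        · left; exact ⟨klct_val_sub_one h1, h1⟩
      have hp2 : ((((v - 1 - 1 : MatsubaraIdx M)) : ℕ) = (((v - 1 : MatsubaraIdx M)) : ℕ) - 1 ∧ 1 ≤ (((v - 1 : MatsubaraIdx M)) : ℕ)) ∨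
          ((((v - 1 - 1 : MatsubaraIdx M)) : ℕ) = 2 * M - 1 ∧ (((v - 1 : MatsubaraIdx M)) : ℕ) = 0) := by
        rcases Nat.lt_or_ge ((((v - 1 : MatsubaraIdx M)) : ℕ)) 1 with h0 | h1
        · right; exact ⟨klct_val_sub_one_of_zero (by omega), by omega⟩
        · left; exact ⟨klct_val_sub_one h1, h1⟩
      have hp3 : ((((v - 1 - 1 - 1 : MatsubaraIdx M)) : ℕ) = (((v - 1 - 1 : MatsubaraIdx M)) : ℕ) - 1 ∧ 1 ≤ (((v - 1 - 1 : MatsubaraIdx M)) : ℕ)) ∨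
          ((((v - 1 - 1 - 1 : MatsubaraIdx M)) : ℕ) = 2 * M - 1 ∧ (((v - 1 - 1 : MatsubaraIdx M)) : ℕ) = 0) := by
        rcases Nat.lt_or_ge ((((v - 1 - 1 : MatsubaraIdx M)) : ℕ)) 1 with h0 | h1
        · right; exact ⟨klct_val_sub_one_of_zero (by omega), by omega⟩
        · left; exact ⟨klct_val_sub_one h1, h1⟩
      have hM3 : 3 ≤ M := by have : (3 : ℝ) ≤ M := hβ3.trans hM; exact_mod_cast this
      have z0 : gnScaleCutoff 4 klE0 1 |matsubaraFreq β M v| = 0 := klct_uvCutoff_edge3_eq_zero hβ3 hM v (Or.inl (by omega))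
      have z1 : gnScaleCutoff 4 klE0 1 |matsubaraFreq β M (v - 1)| = 0 :=
        klct_uvCutoff_edge3_eq_zero hβ3 hM (v - 1) (by rcases hp1 with ⟨h, h'⟩ | ⟨h, h'⟩ <;> omega)
      have z2 : gnScaleCutoff 4 klE0 1 |matsubaraFreq β M (v - 1 - 1)| = 0 :=
        klct_uvCutoff_edge3_eq_zero hβ3 hM (v - 1 - 1) (by
          rcases hp1 with ⟨h, h'⟩ | ⟨h, h'⟩ <;> rcases hp2 with ⟨g, g'⟩ | ⟨g, g'⟩ <;> omega)
      have z3 : gnScaleCutoff 4 klE0 1 |matsubaraFreq β M (v - 1 - 1 - 1)| = 0 :=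
        klct_uvCutoff_edge3_eq_zero hβ3 hM (v - 1 - 1 - 1) (by
          rcases hp1 with ⟨h, h'⟩ | ⟨h, h'⟩ <;> rcases hp2 with ⟨g, g'⟩ | ⟨g, g'⟩ <;> rcases hp3 with ⟨k, k'⟩ | ⟨k, k'⟩ <;> omega)
      rw [z0, z1, z2, z3]; norm_num
  refine (Finset.sum_le_sum (fun v _ => hpt v)).trans ?_
  rw [← Finset.mul_sum, Finset.sum_add_distrib, Finset.sum_ite_mem, Finset.sum_ite_mem, Finset.univ_inter, Finset.univ_inter,
    Finset.sum_const, Finset.sum_const, nsmul_eq_mul, nsmul_eq_mul, mul_one, mul_one,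
    show 4 * K₃ * δ ^ 3 * (3 * β / (64 * Real.pi) + 4) = 2 * K₃ * δ ^ 3 * (2 * (3 * β / (64 * Real.pi) + 4)) by ring]
  gcongr
  -- both windows: inject by `v ↦ n‴ = matsubaraInt v − 3` into integer intervals of length `3β/(64π) + 3`
  have hc : ∀ v : MatsubaraIdx M, matsubaraFreq β M v - 3 * δ = Real.pi * (2 * ((matsubaraInt M v - 3 : ℤ) : ℝ) + 1) / β := by
    intro v; rw [matsubaraFreq, hδ]; push_cast; field_simp; ring
  have hinj : ∀ (W : Finset (MatsubaraIdx M)), Set.InjOn (fun v : MatsubaraIdx M => matsubaraInt M v - 3) (W : Set (MatsubaraIdx M)) := by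
    intro W a _ b _ hab
    simp only [matsubaraInt] at hab
    exact Fin.ext (by exact_mod_cast (by linarith : ((a : ℕ) : ℤ) = b))
  have hδβ : δ * β = 2 * Real.pi := by rw [hδ]; field_simp
  -- window 1
  set T₁ : Finset ℤ := Finset.Ioo ⌊((((1 / 32 - 3 * δ) * β / Real.pi) - 1) / 2 : ℝ)⌋ ⌈(((β / (8 * Real.pi)) - 1) / 2 : ℝ)⌉ with hT₁
  have hmaps₁ : ∀ v ∈ W₁, (matsubaraInt M v - 3) ∈ T₁ := by
    intro v hv
    obtain ⟨_, hw1, hw2⟩ := (Finset.mem_filter.mp hv).2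
    rw [hc v] at hw1 hw2
    set m : ℤ := matsubaraInt M v - 3
    apply klct_mem_Ioo_floor_ceil
    · have : (1 / 32 - 3 * δ) * β / Real.pi < 2 * (m : ℝ) + 1 := by
        rw [div_lt_iff₀ hpi]; rw [lt_div_iff₀ hβ0] at hw1; nlinarith
      linarith
    · have : 2 * (m : ℝ) + 1 < β / (8 * Real.pi) := by
        rw [lt_div_iff₀ (by positivity)]; rw [div_lt_iff₀ hβ0] at hw2; nlinarith
      linarith
  have hcard₁ : ((W₁.card : ℕ) : ℝ) ≤ 3 * β / (64 * Real.pi) + 4 := by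
    have h := Finset.card_le_card_of_injOn _ hmaps₁ (hinj W₁)
    have hR : ((W₁.card : ℕ) : ℝ) ≤ ((T₁.card : ℕ) : ℝ) := by exact_mod_cast h
    refine hR.trans ((klct_card_Ioo_floor_ceil_le ?_).trans (le_of_eq ?_))
    · have : 0 ≤ 3 * β / (64 * Real.pi) := by positivity
      have e : (β / (8 * Real.pi) - 1) / 2 - (((1 / 32 - 3 * δ) * β / Real.pi) - 1) / 2 = 3 * β / (64 * Real.pi) + 3 := by
        field_simp; nlinarith [hδβ]
      linarith
    · field_simp; nlinarith [hδβ]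
  -- window 2
  set T₂ : Finset ℤ := Finset.Ioo ⌊(((-(1 / 8) - 3 * δ) * β / Real.pi - 1) / 2 : ℝ)⌋ ⌈(((-(β / (32 * Real.pi))) - 1) / 2 : ℝ)⌉ with hT₂
  have hmaps₂ : ∀ v ∈ W₂, (matsubaraInt M v - 3) ∈ T₂ := by
    intro v hv
    obtain ⟨_, hw1, hw2⟩ := (Finset.mem_filter.mp hv).2
    rw [hc v] at hw1 hw2
    set m : ℤ := matsubaraInt M v - 3
    apply klct_mem_Ioo_floor_ceil
    · have : (-(1 / 8) - 3 * δ) * β / Real.pi < 2 * (m : ℝ) + 1 := by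
        rw [div_lt_iff₀ hpi]; rw [lt_div_iff₀ hβ0] at hw1; nlinarith
      linarith
    · have : 2 * (m : ℝ) + 1 < -(β / (32 * Real.pi)) := by
        rw [div_lt_iff₀ hβ0] at hw2
        have h32 : (2 * (m : ℝ) + 1) * (32 * Real.pi) < -β := by nlinarith
        rw [← neg_div, lt_div_iff₀ (by positivity)]
        exact h32
      linarith
  have hcard₂ : ((W₂.card : ℕ) : ℝ) ≤ 3 * β / (64 * Real.pi) + 4 := by
    have h := Finset.card_le_card_of_injOn _ hmaps₂ (hinj W₂)
    have hR : ((W₂.card : ℕ) : ℝ) ≤ ((T₂.card : ℕ) : ℝ) := by exact_mod_cast h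
    refine hR.trans ((klct_card_Ioo_floor_ceil_le ?_).trans (le_of_eq ?_))
    · have : 0 ≤ 3 * β / (64 * Real.pi) := by positivity
      have e : ((-(β / (32 * Real.pi))) - 1) / 2 - (((-(1 / 8) - 3 * δ) * β / Real.pi - 1) / 2) = 3 * β / (64 * Real.pi) + 3 := by
        field_simp; nlinarith [hδβ]
      linarith
    · field_simp; nlinarith [hδβ]
  linarith

/-! ## §3 Cubic pointwise decay of the cut leg transform -/

/-- **CUBIC POINTWISE DECAY OF THE CUT LEG TRANSFORM** (`128 ≤ β ≤ M`): for every `j ∈ ℤ_{2M}`,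
`|Σ_v ĝ(ω_v) e^{−2πivj/(2M)}|·(4·min(j, 2M−j)/(2M))³ ≤ C₃(β) = 4K₃(2π/β)³(3β/(64π) + 4)`. -/
theorem klct_legTransform_uvCut_cube_decay {β : ℝ} (hβ : 128 ≤ β) (hM : β ≤ M) (j : ImagTimeIdx M) :
    ‖∑ n : MatsubaraIdx M, (((gnScaleCutoff 4 klE0 1 |matsubaraFreq β M n| : ℝ) : ℂ)) *
        Complex.exp (-((2 * Real.pi * ((n : ℕ) : ℝ) * ((j : ℕ) : ℝ) / (2 * M) : ℝ) : ℂ) * Complex.I)‖ *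
      (4 * min ((j : ℕ) : ℝ) (((2 * M : ℕ) : ℝ) - (j : ℕ)) / ((2 * M : ℕ) : ℝ)) ^ 3 ≤
      4 * ((32 / 3) ^ 3 * 5391) * (2 * Real.pi / β) ^ 3 * (3 * β / (64 * Real.pi) + 4) := by
  have hMne := NeZero.ne M
  have hN : 0 < 2 * M := by omega
  have hcast : (2 * (M : ℝ)) = ((2 * M : ℕ) : ℝ) := by push_cast; ring
  set z : ℂ := Complex.exp (-((2 * Real.pi * ((j : ℕ) : ℝ) / ((2 * M : ℕ) : ℝ) : ℝ) : ℂ) * Complex.I) with hz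
  have hzN : z ^ (2 * M) = 1 := klct_rootOfUnity_pow (N := 2 * M) (j : ℕ)
  have hphase : ∀ n : MatsubaraIdx M,
      Complex.exp (-((2 * Real.pi * ((n : ℕ) : ℝ) * ((j : ℕ) : ℝ) / (2 * M) : ℝ) : ℂ) * Complex.I) = z ^ (n : ℕ) := by
    intro n; rw [hcast]; exact klct_legPhase_eq_pow (N := 2 * M) (n : ℕ) (j : ℕ)
  simp_rw [hphase]
  have hgap := klct_rootOfUnity_gap (N := 2 * M) hN j.isLt
  have hsbp := klct_normCube_mul_norm_sum_le_thirdDiff (fun n : MatsubaraIdx M => (((gnScaleCutoff 4 klE0 1 |matsubaraFreq β M n| : ℝ) : ℂ))) z hzN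
  have hC := klct_thirdDiffSum_uvCut_le hβ hM
  have h0 : 0 ≤ ‖∑ n : MatsubaraIdx M, (((gnScaleCutoff 4 klE0 1 |matsubaraFreq β M n| : ℝ) : ℂ)) * z ^ (n : ℕ)‖ := norm_nonneg _
  have hmin0 : 0 ≤ 4 * min ((j : ℕ) : ℝ) (((2 * M : ℕ) : ℝ) - (j : ℕ)) / ((2 * M : ℕ) : ℝ) := by
    apply div_nonneg _ (by positivity)
    apply mul_nonneg (by norm_num)
    apply le_min (by positivity)
    have : ((j : ℕ) : ℝ) < ((2 * M : ℕ) : ℝ) := by exact_mod_cast j.isLt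
    linarith
  calc _ ≤ ‖∑ n : MatsubaraIdx M, (((gnScaleCutoff 4 klE0 1 |matsubaraFreq β M n| : ℝ) : ℂ)) * z ^ (n : ℕ)‖ * ‖z - 1‖ ^ 3 := by
        apply mul_le_mul_of_nonneg_left _ h0
        exact pow_le_pow_left₀ hmin0 hgap 3
    _ ≤ _ := by rw [mul_comm]; exact hsbp.trans hC

end Summit.HubbardSuperconductivity.HubbardSuperconductivity.Theorems.KLRegimeSplit

end
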